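import Summits.QuantumFields.BalabanUV.T4Continuum.Support.NE7ApeOfTorusRoadV2
import Summits.QuantumFields.BalabanUV.T4Continuum.Support.NE7FlatLiftSplitRow
import HarnessLib

/-!
# NE7ApeOfTorusRoadV3 — THE TORUS ROAD v3 END: v2 (G♭-loc discharged, F255) with the normal part's row LOCALISED as well — the chart's linearised top average is
# SPLIT `D_1A = φ₁ + E` (near datum `φ₁` with coarse curl `ĝ`, far remainder `E` supported at torus block-distance `≥ ℓ` from the plaquette's block with `‖E‖ ≤ s`),
# and the line reads `K·M·((τn + ρ) + e^{−cℓ}(τf + ρ)) + card n·[(C_LIN∕M)(ĝ∕M) + C_far·e^{−κ′ℓ∕2}·s∕M²] + 28α₀² ≤ (c₀ + θr)∕M²` — every exponentially far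
# contribution (shell commutators in `τf`, the averaging commutator in `E`) is discounted; with this END a local chart of PRINT's quality closes the bookkeeping

Cell `pub-balaban`, rung (B)+1 sub-cell t4, lineage `b2b-balaban-t4-ne7-p1` (CRUX PROVER NE7 #1 = OWNER of row NE7), generation 89; memo
`t4/b2b-balaban-t4-ne7-p1-g89/COSTING-N1.md` §1, §3, §5.  File F257 (over F252 `NE7ApeFlatSkeletonLocalised` §2 (the localised bootstrap through a matching gauge), F243
`NE7ApeOfLocalChartLetter.smallField_floor_of_affineImprovement`, F254d `NE7SliceGreenFlatLocalised.sliceGreen_flat_localised` (G♭-loc), F256 `NE7FlatLiftSplitRow`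
(`rightInverse_flat_curl_le_split`, `sum_exp_far_weight_le` — (R7♭)-loc in split form), F251 `NE7ApeOfTorusRoadOwned` ∕ p2 `NE7FlatSkewSlice` (skew part), F44
`hkLift_periodic`, F40b `hess_flat_hkLift_eq_zero`, F48b EXP).

WHY (memo §1).  In v2 (F255) the normal part's curl was read through the GLOBAL (R7♭): `card n(C_H∕M)(ĝ∕M)` with `ĝ` the sup of the coarse curl of the WHOLE datum
`D_1(χA_loc)`, whose shell part carries the chart's gradient constant undiscounted (`≍ C′(R)(r+β)∕R`).  Split `D_1(χA_loc) = χ̄·D_1A_loc + E`: the near datum has coarse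
curl `≲ β_c + quadratic` (no gradient constant) and goes through (R7♭) GLOBAL; the commutator `E` is supported on the shell and goes through the decayed SIZE row (F256).
THIS FILE is the corresponding END: §1 builds the split normal part (skew, periodic, EXACT, NORTH, with the split curl bound at every point), §2 composes it with
F252's bootstrap, G♭-loc and the affine iteration.
WHAT ([folklore] composition; 0 def, 0 sorry; dimension `d + 1 ≥ 2`, `L ≥ 2`).
§1 **`exists_flat_normalPart_split`** — for `A` skew `(L^{k+1}N)`-periodic with `D_1A = φ₁ + E` (`φ₁` `N`-periodic, `‖curlAt 1 φ₁‖ ≤ ĝ`, `‖E(rep y,λ)‖ ≤ W(y)`):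
   `∃ A_N` skew periodic EXACT NORTH with `‖curlAt 1 A_N(z)‖ ≤ card n·[(C_LIN∕M)(ĝ∕M) + M⁻¹·2C_dec·Σ_y e^{−κ′|blk z̄ − y|_T}(d+1)(W(y)∕M)]` at every `z`.
§2 **`hape_of_torusRoadV3`** — `∃ K c ≥∕> 0` (on `d, L, card n`) such that hape ⇐ per plaquette `∃ A φ₁ E α₀ α₁ τn τf ĝ s ℓ u`: chart letters + the split
   `D_1A = φ₁ + E` (φ₁ periodic with coarse curl ≤ ĝ; `E` vanishing on the coarse sites whose block is within `ℓ` of the plaquette's block, `‖E‖ ≤ s`); the two-region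
   defect (regions as in F255); the gauge matching; the line of the title (`C_far = 2(d+1)C_dec·K_{d+1}(κ′∕2)`).
HONEST FRAMING (page 1): composition BY NAME of tree theorems; the per-plaquette bundle is a HYPOTHESIS asserted for nothing — its suppliers (N1)-weak ([B8] Thm 2 TYPE at
`U₀ = 1`, local; INTERFACE REQUEST NE7 of [NE7P1-G89-INBOX-1]), (N2) the two-region defect assembly, (N3)″ the near coarse-curl bound `ĝ` and the commutator size `s` are
NOT in the tree; nothing of Bałaban's asserted; NOT (APE), NOT ONE-STEP, NOT NE7; spine 0∕9; finite T⁴ rung (B)+1 — NOT infinite volume, NOT mass gap, NOT `BetaPertH`,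
NOT Clay.  Continuum YM on T⁴ ⇐ BetaPertH ∧ nine spine estimates (0/9 proved); BetaPertH ⇐ (D1) ∧ (D4) ∧ CAP+tail; G-an2-4 gates asym, D1 and NE2/3/4.
-/

set_option autoImplicit false

open scoped BigOperators Matrix.Norms.L2Operator
open NormedSpace Finset Set

namespace Summit.QuantumFields.BalabanUV.T4Continuum.NE7ApeOfTorusRoadV3

open Literature.MathematicalPhysics.QuantumFieldTheory.Balaban1983to89
open B7Prop1Explicit B7Prop2Explicit MatrixLog UnitaryModel
open T4AveragingDeficitWall (IsUnitaryCfg IsSkewDir SmallField vary curlAt dirL1 flat_mem_classes)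
open T4AveragingDeficitWallBoundary (IsPeriodicCfg periodBox)
open AveragingDeficitPeriodicCounting (IsPeriodicDir)
open AveragingDeficitMultiLevelPrep (LevelSmall TangentIter tower)
open AveragingDeficitMultiLevelBridge (tower_eq)
open MinimalActionLevels (perWin)
open MinimalActionSandwich (admissible)
open MinimalActionRate (sfClass)
open BlockAveragePushDirSplit (flat)
open BlockAverageVaryHolo (nbRad)
open B4Sect5Proof (latticeConst latticeConst_nonneg)
open B4TorusKernel.MultiPeriod (torusSupNorm)
open B5Prop11Plancherel (Tor fine)
open B5Blocks16 (blockOf)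
open B5Hk163Strip (kappa163 kappa163_pos)
open B5Hk163TorusHolderDecay (CdecD CdecD_nonneg)
open B6LowerBound2153Torus (toT rep)
open NE3HessForm (hess dAction)
open NE3TangentCovariantTower (dirIter)
open NE3EnergyShapes (IsUnitarySite)
open NE3CpushGaugeCovariance (dirIter_succ_eq_cpushIter)
open NE7FlatLiftBookkeeping (hkLift_periodic)
open NE7FlatSkewSlice (skewPart isSkewDir_skewPart isPeriodicDir_skewPart skewPart_eq_self dirIter_flat_skewPart isSkewDir_dirIter_flat
  hess_flat_skewPart norm_curlAt_flat_skewPart_le)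
open NE7FlatHkOrthogonal (hess_flat_hkLift_eq_zero)
open NE7ExpansionRemainderFlat (abs_dAction_vary_sub_hess_flat_le)
open NE7TangentTransportGauge (dirIter_skew_periodic)
open NE7CoarseCurvatureLetter (levelSmall_zero)
open NE7ApeOfLocalChartLetter (smallField_floor_of_affineImprovement)
open NE7ApeFlatSkeletonLocalised (norm_plaq_sub_one_le_of_localisedLetters_gauge dirL1_le_add_of_subset_union)
open NE7SliceGreenFlatLocalised (sliceGreen_flat_localised)
open NE7FlatLiftSplitRow (rightInverse_flat_curl_le_split sum_exp_far_weight_le)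

noncomputable section

variable {d : ℕ} {n : Type*} [Fintype n] [DecidableEq n]

/-! ## §1 The split normal part -/

/-- **THE FLAT NORMAL PART WITH THE SPLIT CURL ROW** (dimension `d + 1`): for every skew `(L^{k+1}·N)`-periodic `A` whose linearised top average splits as
`D_1A = φ₁ + E` with `φ₁` `N`-periodic of flat curl `≤ ĝ` and `‖E(rep y, λ)‖ ≤ W(y)`, there is `A_N` skew, periodic, EXACT, NORTH, with
`‖curlAt 1 A_N(z)‖ ≤ card n·[(C_LIN∕M)(ĝ∕M) + M⁻¹·2C_dec·Σ_y e^{−κ′|blk z̄ − y|_T}(d+1)(W(y)∕M)]` at EVERY `z` (F256 §2 + the skew part). [folklore] -/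
theorem exists_flat_normalPart_split [Nonempty n] {L : ℕ} (hL : 1 ≤ L) (k N : ℕ) [NeZero N] [NeZero (L ^ (k + 1))]
    {A : Site (d + 1) → Fin (d + 1) → Matrix n n ℂ} (hA : IsSkewDir A) (hAP : IsPeriodicDir A ((L ^ (k + 1) * N : ℕ) : ℤ))
    (φ₁ E : Site (d + 1) → Fin (d + 1) → Matrix n n ℂ) (hsplit : dirIter L (k + 1) (flat (d := d + 1) (n := n)) A = φ₁ + E)
    (hφ₁P : IsPeriodicDir φ₁ (N : ℤ))
    {g : ℝ} (hg : ∀ (y : Site (d + 1)) (μ ν : Fin (d + 1)), ‖curlAt (flat (d := d + 1) (n := n)) φ₁ y μ ν‖ ≤ g)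
    (W : Tor (fun _ : Fin (d + 1) => N) → ℝ) (hW : ∀ (y : Tor (fun _ : Fin (d + 1) => N)) (lam : Fin (d + 1)), ‖E (rep (fun _ : Fin (d + 1) => N) y) lam‖ ≤ W y) :
    ∃ AN : Site (d + 1) → Fin (d + 1) → Matrix n n ℂ,
      IsSkewDir AN ∧ IsPeriodicDir AN ((L ^ (k + 1) * N : ℕ) : ℤ) ∧
      dirIter L (k + 1) (flat (d := d + 1) (n := n)) AN = dirIter L (k + 1) (flat (d := d + 1) (n := n)) A ∧
      (∀ Y : Site (d + 1) → Fin (d + 1) → Matrix n n ℂ, IsSkewDir Y → IsPeriodicDir Y ((L ^ (k + 1) * N : ℕ) : ℤ) →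
        dirIter L (k + 1) (flat (d := d + 1) (n := n)) Y = 0 →
        hess (flat (d := d + 1) (n := n)) AN Y (perWin (d + 1) (L ^ (k + 1) * N)) = 0) ∧
      ∀ (z : Site (d + 1)) (μ ν : Fin (d + 1)), ‖curlAt (flat (d := d + 1) (n := n)) AN z μ ν‖
        ≤ Fintype.card n * ((2 * (CdecD d * (((d : ℝ) + 1) * (2 * ((d : ℝ) + 1))
              * ((2 + 32 / (kappa163 (d + 1) / (d + 1)) ^ 2) * latticeConst (d + 1) (kappa163 (d + 1) / (d + 1) / 2)))))
              / ((L ^ (k + 1) : ℕ) : ℝ) * (g / ((L ^ (k + 1) : ℕ) : ℝ))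
            + (((L ^ (k + 1) : ℕ) : ℝ))⁻¹ * (2 * (CdecD d * ∑ y : Tor (fun _ : Fin (d + 1) => N),
                Real.exp (-(kappa163 (d + 1) / (d + 1) * torusSupNorm (fun _ : Fin (d + 1) => N)
                  (rep (fun _ : Fin (d + 1) => N) (B5Blocks16.blockOf (L ^ (k + 1)) (fun _ : Fin (d + 1) => N) (toT (fine (L ^ (k + 1)) (fun _ : Fin (d + 1) => N)) z))
                    - rep (fun _ : Fin (d + 1) => N) y)))
                  * (((d : ℝ) + 1) * (W y / ((L ^ (k + 1) : ℕ) : ℝ)))))) := by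
  classical
  have hflatU : IsUnitaryCfg (flat (d := d + 1) (n := n)) := (flat_mem_classes (d := d + 1) (n := n) le_rfl).1
  have hflat0 : SmallField (flat (d := d + 1) (n := n)) 0 := (flat_mem_classes (d := d + 1) (n := n) le_rfl).2
  have htow : ((tower L N (k + 1) : ℕ) : ℤ) = ((L ^ (k + 1) * N : ℕ) : ℤ) := by rw [tower_eq, Nat.mul_comm]
  have hflatPt : IsPeriodicCfg (flat (d := d + 1) (n := n)) ((tower L N (k + 1) : ℕ) : ℤ) := fun _ _ _ => rfl
  have hAPt : IsPeriodicDir A ((tower L N (k + 1) : ℕ) : ℤ) := by rw [htow]; exact hAP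
  obtain ⟨-, hφP⟩ := dirIter_skew_periodic (M := N) hL k hflatU hflatPt le_rfl (levelSmall_zero L k) hflat0 hA hAPt
  -- the split lift (F256 §2): EXACT + the split curl row
  obtain ⟨hexact, hNall⟩ := rightInverse_flat_curl_le_split (n := n) hL k N (dirIter L (k + 1) (flat (d := d + 1) (n := n)) A) φ₁ E hsplit hφP hφ₁P hg W hW
  have hNexact := hexact
  rw [← dirIter_succ_eq_cpushIter L k] at hNexact
  -- PERIODIC (F44)
  have hNP := hkLift_periodic (d := d + 1) (n := n) hL k N
    (fun p : Tor (fun _ : Fin (d + 1) => N) × Fin (d + 1) => (((L ^ (k + 1) : ℕ) : ℂ))⁻¹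
      • dirIter L (k + 1) (flat (d := d + 1) (n := n)) A (B6LowerBound2153Torus.rep (fun _ : Fin (d + 1) => N) p.1) p.2)
  -- NORTH (F40b)
  have hNorth : ∀ Y : Site (d + 1) → Fin (d + 1) → Matrix n n ℂ, IsSkewDir Y → IsPeriodicDir Y ((L ^ (k + 1) * N : ℕ) : ℤ) →
      ReplicationRightInverse.cpushIter L k (flat (d := d + 1) (n := n)) Y = 0 → _ :=
    fun Y hY hYP hYT => hess_flat_hkLift_eq_zero (d := d + 1) (n := n) hL k
      (fun p : Tor (fun _ : Fin (d + 1) => N) × Fin (d + 1) => (((L ^ (k + 1) : ℕ) : ℂ))⁻¹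
        • dirIter L (k + 1) (flat (d := d + 1) (n := n)) A (B6LowerBound2153Torus.rep (fun _ : Fin (d + 1) => N) p.1) p.2) hY hYP hYT
  -- the skew part keeps the letters (p2's R1b), the curl bound pointwise
  refine ⟨skewPart _, isSkewDir_skewPart _, isPeriodicDir_skewPart hNP, ?_, fun Y hY hYP hYT => ?_, fun z μ ν => ?_⟩
  · rw [dirIter_flat_skewPart hL, hNexact, skewPart_eq_self (isSkewDir_dirIter_flat hL (k + 1) hA)]
  · rw [hess_flat_skewPart _ hY]
    exact hNorth Y hY hYP (by rw [dirIter_succ_eq_cpushIter] at hYT; exact hYT)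
  · exact (norm_curlAt_flat_skewPart_le _ z μ ν).trans (hNall z μ ν)


/-! ## §2 THE v3 END -/

/-- **`hape` ⇐ THE PER-PLAQUETTE BUNDLE OF THE TORUS ROAD v3** (dimension `d + 1 ≥ 2`, `L ≥ 2`; statement in the module docstring §2): solver letter AND normal-part
row localised and DISCHARGED; hypotheses = chart, split of its linearised top average, two-region defect, gauge matching, one numeric line.
[cite: Balaban1985Variational, Prop. 8 p.304] -/
theorem hape_of_torusRoadV3 [Nonempty n] (hd : 1 ≤ d) {L : ℕ} [NeZero L] (hL : 2 ≤ L) :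
    ∃ K c : ℝ, 0 ≤ K ∧ 0 < c ∧ ∀ (N : ℕ) [NeZero N] (ε δ δ₁ β c₀ θ : ℝ), 0 ≤ c₀ → 0 ≤ θ → θ < 1 → c₀ + θ * δ ≤ δ → c₀ / (1 - θ) < δ₁ →
    (∀ D : Site (d + 1) → Fin (d + 1) → (Matrix n n ℂ)ˣ, IsUnitaryCfg D → IsPeriodicCfg D (N : ℤ) → SmallField D (4 * (Real.exp β - 1)) →
      ∀ (k : ℕ), ∀ U ∈ admissible (sfClass (d + 1) L N ε) L (k + 1) D,
      (∀ φ : Site (d + 1) → Fin (d + 1) → Matrix n n ℂ, IsSkewDir φ → IsPeriodicDir φ ((N * L ^ (k + 1) : ℕ) : ℤ) → TangentIter L k U φ →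
        dAction U φ (perWin (d + 1) (N * L ^ (k + 1))) = 0) →
      ∀ r : ℝ, 0 ≤ r → r ≤ δ → SmallField U (r / ((L : ℝ) ^ (k + 1)) ^ 2) →
      ∀ (z : Site (d + 1)) (μ ν : Fin (d + 1)), μ ≠ ν →
        ∃ (A φ₁ E : Site (d + 1) → Fin (d + 1) → Matrix n n ℂ) (α₀ α₁ τn τf g s ℓ : ℝ) (u : Site (d + 1) → (Matrix n n ℂ)ˣ),
          -- the chart, cut off ((N1)-weak + cutoff)
          (IsSkewDir A ∧ IsPeriodicDir A ((N * L ^ (k + 1) : ℕ) : ℤ) ∧ 0 ≤ α₀ ∧ 0 ≤ α₁ ∧ (∀ y κ, ‖A y κ‖ ≤ α₀) ∧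
            (∀ (y : Site (d + 1)) (κ τ' : Fin (d + 1)), ‖A (y + e τ') κ - A y κ‖ ≤ α₁)) ∧
          -- the SPLIT of its linearised top average: near datum `φ₁` (coarse curl `ĝ`), far remainder `E` (size `s`, zero within `ℓ` blocks of the plaquette's block)
          (dirIter L (k + 1) (flat (d := d + 1) (n := n)) A = φ₁ + E ∧ IsPeriodicDir φ₁ (N : ℤ) ∧
            (∀ (y : Site (d + 1)) (μ' ν' : Fin (d + 1)), ‖curlAt (flat (d := d + 1) (n := n)) φ₁ y μ' ν'‖ ≤ g) ∧ 0 ≤ s ∧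
            (∀ (y : Tor (fun _ : Fin (d + 1) => N)) (lam : Fin (d + 1)), ‖E (rep (fun _ : Fin (d + 1) => N) y) lam‖ ≤ s) ∧
            (∀ (y : Tor (fun _ : Fin (d + 1) => N)), torusSupNorm (fun _ : Fin (d + 1) => N) (rep (fun _ : Fin (d + 1) => N) y
                - rep (fun _ : Fin (d + 1) => N) (B5Blocks16.blockOf (L ^ (k + 1)) (fun _ : Fin (d + 1) => N)
                            (toT (fine (L ^ (k + 1)) (fun _ : Fin (d + 1) => N)) z))) < ℓ →
              ∀ lam : Fin (d + 1), E (rep (fun _ : Fin (d + 1) => N) y) lam = 0)) ∧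
          -- the two-region criticality defect ((N2))
          (0 ≤ τn ∧ 0 ≤ τf ∧ ∀ Y : Site (d + 1) → Fin (d + 1) → Matrix n n ℂ, IsSkewDir Y → IsPeriodicDir Y ((N * L ^ (k + 1) : ℕ) : ℤ) →
            dirIter L (k + 1) (flat (d := d + 1) (n := n)) Y = 0 →
            |dAction (vary (flat (d := d + 1) (n := n)) A 1) Y (perWin (d + 1) (N * L ^ (k + 1)))|
              ≤ τn * dirL1 Y ((periodBox (d := d + 1) (N * L ^ (k + 1))).filter (fun x => ¬ (ℓ + nbRad (d + 1) L + 1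
                    ≤ torusSupNorm (fun _ : Fin (d + 1) => N) ((fun i => x i / ((L ^ (k + 1) : ℕ) : ℤ))
                        - rep (fun _ : Fin (d + 1) => N) (B5Blocks16.blockOf (L ^ (k + 1)) (fun _ : Fin (d + 1) => N)
                            (toT (fine (L ^ (k + 1)) (fun _ : Fin (d + 1) => N)) z))))))
                + τf * dirL1 Y ((periodBox (d := d + 1) (N * L ^ (k + 1))).filter (fun x => ℓ + nbRad (d + 1) L + 1
                    ≤ torusSupNorm (fun _ : Fin (d + 1) => N) ((fun i => x i / ((L ^ (k + 1) : ℕ) : ℤ))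
                        - rep (fun _ : Fin (d + 1) => N) (B5Blocks16.blockOf (L ^ (k + 1)) (fun _ : Fin (d + 1) => N)
                            (toT (fine (L ^ (k + 1)) (fun _ : Fin (d + 1) => N)) z)))))) ∧
          -- the gauge matching `U` to `e^{A}` on the four bonds of the plaquette
          (IsUnitarySite u ∧ gaugeAct u U z μ = vary (flat (d := d + 1) (n := n)) A 1 z μ ∧
            gaugeAct u U (z + e μ) ν = vary (flat (d := d + 1) (n := n)) A 1 (z + e μ) ν ∧
            gaugeAct u U (z + e ν) μ = vary (flat (d := d + 1) (n := n)) A 1 (z + e ν) μ ∧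
            gaugeAct u U z ν = vary (flat (d := d + 1) (n := n)) A 1 z ν) ∧
          -- the numeric line
          K * (L : ℝ) ^ (k + 1) * ((τn + ((Fintype.card (T4AveragingDeficitWall.Plane (d + 1)) : ℝ)
              * (2 * (8 * α₀ * (2 * α₁ + 28 * α₀ ^ 2) + 6 * (Real.exp α₀ - 1) * (2 * α₁ + 24 * (Real.exp α₀ - 1) * α₀)
                  + (2 * α₁ + 24 * (Real.exp α₀ - 1) * α₀) * (2 * α₁ + 28 * α₀ ^ 2) + 960 * (Real.exp α₀ - 1) * α₀ ^ 2)
                + 64 * α₀ * α₁)))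
              + Real.exp (-(c * ℓ)) * (τf + ((Fintype.card (T4AveragingDeficitWall.Plane (d + 1)) : ℝ)
              * (2 * (8 * α₀ * (2 * α₁ + 28 * α₀ ^ 2) + 6 * (Real.exp α₀ - 1) * (2 * α₁ + 24 * (Real.exp α₀ - 1) * α₀)
                  + (2 * α₁ + 24 * (Real.exp α₀ - 1) * α₀) * (2 * α₁ + 28 * α₀ ^ 2) + 960 * (Real.exp α₀ - 1) * α₀ ^ 2)
                + 64 * α₀ * α₁))))
            + Fintype.card n * ((2 * (CdecD d * (((d : ℝ) + 1) * (2 * ((d : ℝ) + 1))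
              * ((2 + 32 / (kappa163 (d + 1) / (d + 1)) ^ 2) * latticeConst (d + 1) (kappa163 (d + 1) / (d + 1) / 2)))))
                / ((L ^ (k + 1) : ℕ) : ℝ) * (g / ((L ^ (k + 1) : ℕ) : ℝ))
              + (((L ^ (k + 1) : ℕ) : ℝ))⁻¹ * (2 * (CdecD d * ((((d : ℝ) + 1) / ((L ^ (k + 1) : ℕ) : ℝ))
                * (s * latticeConst (d + 1) (kappa163 (d + 1) / (d + 1) / 2) * Real.exp (-(kappa163 (d + 1) / (d + 1) / 2 * ℓ)))))))
            + 28 * α₀ ^ 2 ≤ (c₀ + θ * r) / ((L : ℝ) ^ (k + 1)) ^ 2) →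
    ∀ D : Site (d + 1) → Fin (d + 1) → (Matrix n n ℂ)ˣ, IsUnitaryCfg D → IsPeriodicCfg D (N : ℤ) → SmallField D (4 * (Real.exp β - 1)) →
      ∀ (k : ℕ), ∀ U ∈ admissible (sfClass (d + 1) L N ε) L (k + 1) D, SmallField U (δ / ((L : ℝ) ^ (k + 1)) ^ 2) →
      (∀ φ : Site (d + 1) → Fin (d + 1) → Matrix n n ℂ, IsSkewDir φ → IsPeriodicDir φ ((N * L ^ (k + 1) : ℕ) : ℤ) → TangentIter L k U φ →
        dAction U φ (perWin (d + 1) (N * L ^ (k + 1))) = 0) → SmallField U (δ₁ / ((L : ℝ) ^ (k + 1)) ^ 2) := by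
  classical
  obtain ⟨K, c, hK, hc, hG⟩ := sliceGreen_flat_localised (n := n) hd hL
  refine ⟨K, c, hK, hc, ?_⟩
  intro N _ ε δ δ₁ β c₀ θ hc₀ hθ0 hθ1 hcδ hδ₁ hloc D hDu hDP hDs k U hU hUδ hcrit
  have hL1 : 1 ≤ L := by omega
  have hLpos : (0 : ℝ) < L := by exact_mod_cast (by omega : 0 < L)
  have hS : 0 < ((L : ℝ) ^ (k + 1)) ^ 2 := by positivity
  have hmc : N * L ^ (k + 1) = L ^ (k + 1) * N := Nat.mul_comm _ _
  have hP1 : 1 ≤ N * L ^ (k + 1) := Nat.one_le_iff_ne_zero.mpr (Nat.mul_ne_zero (NeZero.ne N) (pow_ne_zero _ (by omega)))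
  have hMpos : (0 : ℝ) < ((L ^ (k + 1) : ℕ) : ℝ) := by positivity
  have hflatU : IsUnitaryCfg (flat (d := d + 1) (n := n)) := (flat_mem_classes (d := d + 1) (n := n) le_rfl).1
  have hflat0 : SmallField (flat (d := d + 1) (n := n)) 0 := (flat_mem_classes (d := d + 1) (n := n) le_rfl).2
  have hκ2 : 0 < kappa163 (d + 1) / (d + 1) / 2 := by have := kappa163_pos (d + 1); positivity
  -- the affine improvement at this configuration, plaquette by plaquette
  have himp : ∀ r : ℝ, 0 ≤ r → r ≤ δ → SmallField U (r / ((L : ℝ) ^ (k + 1)) ^ 2) →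
      SmallField U ((c₀ + θ * r) / ((L : ℝ) ^ (k + 1)) ^ 2) := by
    intro r hr0 hrδ hUr z μ ν hμν
    obtain ⟨A, φ₁, E, α₀, α₁, τn, τf, g, s, ℓ, u, ⟨hA, hAP, hα₀, hα₁, hAα, hA1⟩, ⟨hsplit, hφ₁P, hg, hs0, hEs, hE0⟩, ⟨hτn, hτf, hcritD⟩,
      ⟨hu, h1, h2, h3, h4⟩, hnum⟩ := hloc D hDu hDP hDs k U hU hcrit r hr0 hrδ hUr z μ ν hμν
    -- EXP's global density `ρ(α₀, α₁)` (F48b), abbreviated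
    set ρx : ℝ := ((Fintype.card (T4AveragingDeficitWall.Plane (d + 1)) : ℝ)
              * (2 * (8 * α₀ * (2 * α₁ + 28 * α₀ ^ 2) + 6 * (Real.exp α₀ - 1) * (2 * α₁ + 24 * (Real.exp α₀ - 1) * α₀)
                  + (2 * α₁ + 24 * (Real.exp α₀ - 1) * α₀) * (2 * α₁ + 28 * α₀ ^ 2) + 960 * (Real.exp α₀ - 1) * α₀ ^ 2)
                + 64 * α₀ * α₁)) with hρx
    have hδe : 0 ≤ Real.exp α₀ - 1 := by linarith [Real.add_one_le_exp α₀]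
    have hρ0 : 0 ≤ ρx := by rw [hρx]; positivity
    -- the plaquette's block and the two regions
    set y₀ : Tor (fun _ : Fin (d + 1) => N) :=
      B5Blocks16.blockOf (L ^ (k + 1)) (fun _ : Fin (d + 1) => N) (toT (fine (L ^ (k + 1)) (fun _ : Fin (d + 1) => N)) z) with hy₀
    set Bf : Finset (Site (d + 1)) := (periodBox (d := d + 1) (N * L ^ (k + 1))).filter (fun x => ℓ + nbRad (d + 1) L + 1
        ≤ torusSupNorm (fun _ : Fin (d + 1) => N) ((fun i => x i / ((L ^ (k + 1) : ℕ) : ℤ)) - rep (fun _ : Fin (d + 1) => N) y₀)) with hBf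
    set Bn : Finset (Site (d + 1)) := (periodBox (d := d + 1) (N * L ^ (k + 1))).filter (fun x => ¬ (ℓ + nbRad (d + 1) L + 1
        ≤ torusSupNorm (fun _ : Fin (d + 1) => N) ((fun i => x i / ((L ^ (k + 1) : ℕ) : ℤ)) - rep (fun _ : Fin (d + 1) => N) y₀))) with hBn
    have hcover : periodBox (d := d + 1) (N * L ^ (k + 1)) ⊆ Bn ∪ Bf := by
      intro x hx
      rw [Finset.mem_union, hBn, hBf, Finset.mem_filter, Finset.mem_filter]
      by_cases h : ℓ + nbRad (d + 1) L + 1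
          ≤ torusSupNorm (fun _ : Fin (d + 1) => N) ((fun i => x i / ((L ^ (k + 1) : ℕ) : ℤ)) - rep (fun _ : Fin (d + 1) => N) y₀)
      · exact Or.inr ⟨hx, h⟩
      · exact Or.inl ⟨hx, h⟩
    have hBnP : Bn ⊆ periodBox (d := d + 1) (L ^ (k + 1) * N) := by rw [← hmc]; exact Finset.filter_subset _ _
    have hBfP : Bf ⊆ periodBox (d := d + 1) (L ^ (k + 1) * N) := by rw [← hmc]; exact Finset.filter_subset _ _
    have hBffar : ∀ x ∈ Bf, ℓ + nbRad (d + 1) L + 1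
        ≤ torusSupNorm (fun _ : Fin (d + 1) => N) ((fun i => x i / ((L ^ (k + 1) : ℕ) : ℤ)) - rep (fun _ : Fin (d + 1) => N) y₀) :=
      fun x hx => (Finset.mem_filter.mp hx).2
    -- G♭-loc at this plaquette (F254d), period spelled `N·L^{k+1}`
    have hGloc : ∀ X : Site (d + 1) → Fin (d + 1) → Matrix n n ℂ, X ∈ (Set.univ : Set (Site (d + 1) → Fin (d + 1) → Matrix n n ℂ)) → IsSkewDir X →
        IsPeriodicDir X ((N * L ^ (k + 1) : ℕ) : ℤ) → dirIter L (k + 1) (flat (d := d + 1) (n := n)) X = 0 → ∀ a b : ℝ, 0 ≤ a → 0 ≤ b →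
        (∀ Y : Site (d + 1) → Fin (d + 1) → Matrix n n ℂ, IsSkewDir Y → IsPeriodicDir Y ((N * L ^ (k + 1) : ℕ) : ℤ) →
          dirIter L (k + 1) (flat (d := d + 1) (n := n)) Y = 0 →
          |hess (flat (d := d + 1) (n := n)) X Y (perWin (d + 1) (N * L ^ (k + 1)))| ≤ a * dirL1 Y Bn + b * dirL1 Y Bf) →
        ‖curlAt (flat (d := d + 1) (n := n)) X z μ ν‖ ≤ K * (L : ℝ) ^ (k + 1) * (a + Real.exp (-(c * ℓ)) * b) := by
      intro X _ hXs hXP hXT a b ha hb hsrc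
      rw [hmc] at hXP hsrc
      exact hG k N y₀ ℓ X hXs hXP hXT Bn Bf hBnP hBfP hBffar a b ha hb hsrc z rfl μ ν
    -- the split normal part (§1), period spelled `N·L^{k+1}`; weight `W = s·[far]`
    have hAP' : IsPeriodicDir A ((L ^ (k + 1) * N : ℕ) : ℤ) := by rw [← hmc]; exact hAP
    set W : Tor (fun _ : Fin (d + 1) => N) → ℝ := fun y =>
      if torusSupNorm (fun _ : Fin (d + 1) => N) (rep (fun _ : Fin (d + 1) => N) y - rep (fun _ : Fin (d + 1) => N) y₀) < ℓ then 0 else s with hWdef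
    have hW : ∀ (y : Tor (fun _ : Fin (d + 1) => N)) (lam : Fin (d + 1)), ‖E (rep (fun _ : Fin (d + 1) => N) y) lam‖ ≤ W y := by
      intro y lam
      simp only [hWdef]
      split_ifs with hnear
      · rw [hE0 y hnear lam, norm_zero]
      · exact hEs y lam
    have hWs : ∀ y, W y ≤ s := fun y => by simp only [hWdef]; split_ifs <;> linarith
    have hWnear : ∀ y, torusSupNorm (fun _ : Fin (d + 1) => N) (rep (fun _ : Fin (d + 1) => N) y - rep (fun _ : Fin (d + 1) => N) y₀) < ℓ → W y ≤ 0 :=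
      fun y hy => by simp only [hWdef]; rw [if_pos hy]
    obtain ⟨AN, hNs, hNP, hNexact, hNorth, hNcurl⟩ := exists_flat_normalPart_split (n := n) hL1 k N hA hAP' φ₁ E hsplit hφ₁P hg W hW
    have hNP' : IsPeriodicDir AN ((N * L ^ (k + 1) : ℕ) : ℤ) := by rw [hmc]; exact hNP
    have hNorth' : ∀ Y : Site (d + 1) → Fin (d + 1) → Matrix n n ℂ, IsSkewDir Y → IsPeriodicDir Y ((N * L ^ (k + 1) : ℕ) : ℤ) →
        dirIter L (k + 1) (flat (d := d + 1) (n := n)) Y = 0 →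
        hess (flat (d := d + 1) (n := n)) AN Y (perWin (d + 1) (N * L ^ (k + 1))) = 0 := by
      intro Y hY hYP hYT
      rw [hmc] at hYP ⊢
      exact hNorth Y hY hYP hYT
    -- the far weight is discounted (F256 §3)
    have hfarsum := sum_exp_far_weight_le (d := d) (fun _ : Fin (d + 1) => N) y₀ W hs0 hWs hWnear
    -- EXP (F48b) entered in both regions through `periodBox ⊆ Bn ∪ Bf`
    have hEXP2 : ∀ Y : Site (d + 1) → Fin (d + 1) → Matrix n n ℂ, IsSkewDir Y → IsPeriodicDir Y ((N * L ^ (k + 1) : ℕ) : ℤ) →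
        |dAction (vary (flat (d := d + 1) (n := n)) A 1) Y (perWin (d + 1) (N * L ^ (k + 1)))
            - hess (flat (d := d + 1) (n := n)) A Y (perWin (d + 1) (N * L ^ (k + 1)))| ≤ ρx * dirL1 Y Bn + ρx * dirL1 Y Bf := by
      intro Y hY hYP
      have h := abs_dAction_vary_sub_hess_flat_le hP1 hA hAP hα₀ hα₁ hAα hA1 hY hYP
      rw [← hρx] at h
      have hcov := dirL1_le_add_of_subset_union Y hcover
      have hmul : ρx * dirL1 Y (periodBox (d := d + 1) (N * L ^ (k + 1))) ≤ ρx * (dirL1 Y Bn + dirL1 Y Bf) :=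
        mul_le_mul_of_nonneg_left hcov hρ0
      linarith
    -- F252 §2 at this plaquette, `S := univ`
    have hplaq := norm_plaq_sub_one_le_of_localisedLetters_gauge (d := d + 1) (n := n) hL1 k hflatU hflat0 le_rfl (levelSmall_zero L k) hflat0
      hA hAP hAα hNs hNP' hNexact hNorth' Set.univ (Set.mem_univ _) Bn Bf z hμν hGloc hρ0 hρ0 hEXP2 hτn hτf hcritD hu h1 h2 h3 h4
    -- the normal curl at the plaquette: split row (§1) + the far discount
    have hcurlN := hNcurl z μ ν
    have hsumW : ∑ y : Tor (fun _ : Fin (d + 1) => N),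
        Real.exp (-(kappa163 (d + 1) / (d + 1) * torusSupNorm (fun _ : Fin (d + 1) => N)
          (rep (fun _ : Fin (d + 1) => N) y₀ - rep (fun _ : Fin (d + 1) => N) y))) * (((d : ℝ) + 1) * (W y / ((L ^ (k + 1) : ℕ) : ℝ)))
        ≤ (((d : ℝ) + 1) / ((L ^ (k + 1) : ℕ) : ℝ))
          * (s * latticeConst (d + 1) (kappa163 (d + 1) / (d + 1) / 2) * Real.exp (-(kappa163 (d + 1) / (d + 1) / 2 * ℓ))) := by
      have e : ∑ y : Tor (fun _ : Fin (d + 1) => N),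
          Real.exp (-(kappa163 (d + 1) / (d + 1) * torusSupNorm (fun _ : Fin (d + 1) => N)
            (rep (fun _ : Fin (d + 1) => N) y₀ - rep (fun _ : Fin (d + 1) => N) y))) * (((d : ℝ) + 1) * (W y / ((L ^ (k + 1) : ℕ) : ℝ)))
          = (((d : ℝ) + 1) / ((L ^ (k + 1) : ℕ) : ℝ)) * ∑ y : Tor (fun _ : Fin (d + 1) => N),
            Real.exp (-(kappa163 (d + 1) / (d + 1) * torusSupNorm (fun _ : Fin (d + 1) => N)
              (rep (fun _ : Fin (d + 1) => N) y₀ - rep (fun _ : Fin (d + 1) => N) y))) * W y := by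
        rw [Finset.mul_sum]
        refine Finset.sum_congr rfl fun y _ => ?_
        field_simp
      rw [e]
      exact mul_le_mul_of_nonneg_left hfarsum (by positivity)
    have hcurlN' : ‖curlAt (flat (d := d + 1) (n := n)) AN z μ ν‖
        ≤ Fintype.card n * ((2 * (CdecD d * (((d : ℝ) + 1) * (2 * ((d : ℝ) + 1))
              * ((2 + 32 / (kappa163 (d + 1) / (d + 1)) ^ 2) * latticeConst (d + 1) (kappa163 (d + 1) / (d + 1) / 2)))))
            / ((L ^ (k + 1) : ℕ) : ℝ) * (g / ((L ^ (k + 1) : ℕ) : ℝ))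
          + (((L ^ (k + 1) : ℕ) : ℝ))⁻¹ * (2 * (CdecD d * ((((d : ℝ) + 1) / ((L ^ (k + 1) : ℕ) : ℝ))
            * (s * latticeConst (d + 1) (kappa163 (d + 1) / (d + 1) / 2) * Real.exp (-(kappa163 (d + 1) / (d + 1) / 2 * ℓ))))))) := by
      refine hcurlN.trans (mul_le_mul_of_nonneg_left (add_le_add le_rfl (mul_le_mul_of_nonneg_left
        (mul_le_mul_of_nonneg_left (mul_le_mul_of_nonneg_left hsumW CdecD_nonneg) (by norm_num)) (by positivity))) (by positivity))
    exact hplaq.trans (by linarith)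
  exact smallField_floor_of_affineImprovement hS hc₀ hθ0 hθ1 hcδ hδ₁ himp hUδ

end

end Summit.QuantumFields.BalabanUV.T4Continuum.NE7ApeOfTorusRoadV3
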